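import Summits.ABC.StewartYu.PadicTwistPMMain
import Summits.ABC.StewartYu.PadicTwistPMExpClass
import Summits.ABC.StewartYu.DescentStepQParts
import HarnessLib

/-!
# Cell abc-stewartyu, WP-Y provider B (xi-a): the descent with the ± class (explicit pivot) + auxiliaries

`Summits/ABC/StewartYu/PadicTwistPMDescent.lean` — seat p3 (crux `W80OneModFour` stmt-ABC-19487; memo-05 §3–§4).
STAGED by p3-g2 (kernel-checked inside HOME/p3/lean/pm/CHECK_PM_chain.lean); FILE after PadicTwistPMMain.
[folklore].
-/

noncomputable section

open NormedSpace Finset IsUltrametricDist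
open Literature.NumberTheory.Transcendental
open Literature.NumberTheory.Transcendental.CW77.Setup (Idx Tau tauNorm)
open scoped Nat

namespace Summit.ABC.StewartYu


namespace TwistSetup

variable {p : ℕ} [Fact p.Prime] (S : TwistSetup p) {h Lb : ℕ}

/-- In a field, `x² = y²` forces `x = y` or `x = −y`. [folklore] -/
theorem eq_or_eq_neg_of_sq_eq' {x y : ℚ_[p]} (h2 : x ^ 2 = y ^ 2) : x = y ∨ x = -y :=
  sq_eq_sq_iff_eq_or_eq_neg.mp h2

open Classical in
/-- **The descent with the ± class (provider B).** From the ± invariant at level `J`, a sign function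
`χ = ±1`, and the vanishing of the class sums of the twisted vector `χ·pv` restricted to EACH exact
sub-class `{u : cls u = ρ}` and `{u : cls u = −ρ}` (`s` odd `< 2^{J+1}S₀`, `|τ| < T/2^{J+1}`) — which is
what part 3 delivers — the ± invariant at level `J + 1`: restrict to the sub-class of a pivot `u₀`,
re-index by `λ = ε + 2λ''` (p3's descent algebra), and update the class by `cls(ε + 2v) = cls₀(ε)·cls(v)²`:
all new class values have the same square, hence are `±σ₁` for the class value `σ₁` of one of them.
[folklore] -/
theorem descent_class_pm {J₀ J : ℕ} {L : Fin S.d → ℕ} {Lθ S₀ T : ℕ} {P : ℤ}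
    {pv : Idx S.d h Lb → ℤ} (inv : S.InvPM J₀ L Lθ S₀ T P J pv) (χ : Idx S.d h Lb → ℤ)
    (hχ : ∀ u, χ u = 1 ∨ χ u = -1)
    (half : ∀ ρ' : ℚ_[p], ∀ s, s < 2 ^ (J + 1) * S₀ → Odd s → ∀ τ : Tau S.d,
      tauNorm τ < T / 2 ^ (J + 1) →
      S.toQ.classVec J₀ J (S.toQ.flat.box (h := h) (Lb := Lb) L Lθ J)
        (fun u => if S.cls u = ρ' then χ u * pv u else 0) τ s = 0) :
    ∃ pv' : Idx S.d h Lb → ℤ, S.InvPM J₀ L Lθ S₀ T P (J + 1) pv' := by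
  classical
  obtain ⟨u₀, hu₀⟩ := inv.inv.nonzero
  obtain ⟨ρ, sgn, hρG, hsgn, hcls⟩ := inv.cls
  -- the exact sub-class of the pivot
  set ρs : ℚ_[p] := S.cls u₀ with hρs
  set w : Idx S.d h Lb → ℤ := fun u => if S.cls u = ρs then χ u * pv u else 0 with hw
  have hχne : ∀ u, χ u ≠ 0 := fun u => by rcases hχ u with h1 | h1 <;> simp [h1]
  have hwu₀ : w u₀ ≠ 0 := by
    simp only [hw, hρs, if_true]
    exact mul_ne_zero (hχne u₀) hu₀
  have hw_pv : ∀ u, w u ≠ 0 → pv u ≠ 0 ∧ S.cls u = ρs := by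
    intro u hu
    by_cases hc : S.cls u = ρs
    · refine ⟨?_, hc⟩
      simp only [hw, if_pos hc] at hu
      exact fun h0 => hu (by rw [h0, mul_zero])
    · exact absurd (by simp only [hw, if_neg hc]) hu
  have hsupp : ∀ u, w u ≠ 0 → u ∈ S.toQ.flat.box (h := h) (Lb := Lb) L Lθ J :=
    fun u hu => inv.inv.supp u (hw_pv u hu).1
  have hbound : ∀ u, |w u| ≤ P := by
    intro u
    have hP0 : (0 : ℤ) ≤ P := le_trans (abs_nonneg _) (inv.inv.bound u₀)
    by_cases hc : S.cls u = ρs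
    · simp only [hw, if_pos hc, abs_mul]
      rcases hχ u with h1 | h1 <;> rw [h1] <;> simpa using inv.inv.bound u
    · simp only [hw, if_neg hc, abs_zero]; exact hP0
  -- the algebraic descent on `w`
  have key := SetupQPM.inv_succ_of_parts S.toQ u₀ hwu₀ hsupp hbound (half ρs)
  set ε : Fin S.d → ℕ := fun j => u₀.2.1 j % 2 with hεdef
  set εθ : ℕ := u₀.2.2 % 2 with hεθdef
  set pv' : Idx S.d h Lb → ℤ := fun v => w (S.toQ.flat.reidx ε εθ v) with hpv'
  refine ⟨pv', key, ?_⟩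
  -- the class update
  obtain ⟨v₀, hv₀⟩ := key.nonzero
  set σ₁ : ℚ_[p] := S.cls v₀ with hσ₁
  have hsq : ∀ v, pv' v ≠ 0 → S.cls v ^ 2 = σ₁ ^ 2 := by
    intro v hv
    have h1 := (hw_pv _ hv).2
    have h0 := (hw_pv _ hv₀).2
    rw [S.cls_reidx] at h1 h0
    have hprod : (∏ i, S.η i ^ S.frame.resVec ε εθ i) ≠ 0 :=
      prod_ne_zero_iff.mpr fun i _ => pow_ne_zero _ (S.η_ne i)
    have := h1.trans h0.symm
    rw [hσ₁]
    exact mul_left_cancel₀ hprod this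
  refine ⟨σ₁, fun v => if S.cls v = σ₁ then 1 else -1, S.cls_pow_G v₀, ?_, ?_⟩
  · intro v _
    by_cases hc : S.cls v = σ₁
    · left; simp [hc]
    · right; simp [hc]
  · intro v hv
    show S.cls v = ((if S.cls v = σ₁ then (1 : ℤ) else -1 : ℤ) : ℚ_[p]) * σ₁
    rcases eq_or_eq_neg_of_sq_eq' (hsq v hv) with hc | hc
    · rw [if_pos hc, hc]; push_cast; ring
    · have hne : S.cls v ≠ σ₁ := by
        intro heq
        have h2 : σ₁ = -σ₁ := heq.symm.trans hc
        have : σ₁ = 0 := by linear_combination h2 / 2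
        exact S.cls_ne v₀ (hσ₁ ▸ this)
      rw [if_neg hne, hc]; push_cast; ring

end TwistSetup





/-! ## HalfStepPM (provider B), part 5d-iii — auxiliary: `s`-linearity of the exponent class, linearity of
`classVec`, the descent with an EXPLICIT pivot, uniform sign on a class. -/

namespace TwistSetup

variable {p : ℕ} [Fact p.Prime] (S : TwistSetup p) {h Lb : ℕ}

/-- `∑ rᵢ expnᵢ(u,s) = s · ∑ rᵢ expnᵢ(u,1)`. [folklore] -/
theorem expSum_mul (r : Fin (S.d + 1) → ℕ) (u : Idx S.d h Lb) (s : ℕ) :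
    ∑ i, r i * S.frame.expn u s i = s * ∑ i, r i * S.frame.expn u 1 i := by
  rw [mul_sum, Fin.sum_univ_castSucc, Fin.sum_univ_castSucc]
  simp only [frame_expn_castSucc, frame_expn_last, mul_one]
  rw [add_comm, add_comm (∑ x : Fin S.d, s * (r (Fin.castSucc x) * u.2.1 x)) _]
  congr 1
  · ring
  · exact sum_congr rfl fun x _ => by ring

/-- `classVec` is linear in the coefficient vector: scaling by an integer. [folklore] -/
theorem classVec_smul (J₀ J : ℕ) (box : Finset (Idx S.d h Lb)) (w : Idx S.d h Lb → ℤ) (ε : ℤ)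
    (τ : Tau S.d) (s : ℕ) :
    S.toQ.classVec J₀ J box (fun u => ε * w u) τ s = fun T' => (ε : ℚ) * S.toQ.classVec J₀ J box w τ s T' := by
  funext T'
  unfold SetupQ.classVec
  rw [mul_sum]
  refine sum_congr rfl fun u _ => ?_
  push_cast; ring

open Classical in
/-- Part 4 with an EXPLICIT pivot `u₀` (`pv u₀ ≠ 0`): the vanishing hypothesis is needed only for the
sub-class of `u₀`. [folklore] -/
theorem descent_class_pm' {J₀ J : ℕ} {L : Fin S.d → ℕ} {Lθ S₀ T : ℕ} {P : ℤ}
    {pv : Idx S.d h Lb → ℤ} (inv : S.InvPM J₀ L Lθ S₀ T P J pv) (χ : Idx S.d h Lb → ℤ)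
    (hχ : ∀ u, χ u = 1 ∨ χ u = -1) (u₀ : Idx S.d h Lb) (hu₀ : pv u₀ ≠ 0)
    (half : ∀ s, s < 2 ^ (J + 1) * S₀ → Odd s → ∀ τ : Tau S.d,
      tauNorm τ < T / 2 ^ (J + 1) →
      S.toQ.classVec J₀ J (S.toQ.flat.box (h := h) (Lb := Lb) L Lθ J)
        (fun u => if S.cls u = S.cls u₀ then χ u * pv u else 0) τ s = 0) :
    ∃ pv' : Idx S.d h Lb → ℤ, S.InvPM J₀ L Lθ S₀ T P (J + 1) pv' := by
  classical
  obtain ⟨ρ, sgn, hρG, hsgn, hcls⟩ := inv.cls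
  set ρs : ℚ_[p] := S.cls u₀ with hρs
  set w : Idx S.d h Lb → ℤ := fun u => if S.cls u = ρs then χ u * pv u else 0 with hw
  have hχne : ∀ u, χ u ≠ 0 := fun u => by rcases hχ u with h1 | h1 <;> simp [h1]
  have hwu₀ : w u₀ ≠ 0 := by
    simp only [hw, hρs, if_true]
    exact mul_ne_zero (hχne u₀) hu₀
  have hw_pv : ∀ u, w u ≠ 0 → pv u ≠ 0 ∧ S.cls u = ρs := by
    intro u hu
    by_cases hc : S.cls u = ρs
    · refine ⟨?_, hc⟩
      simp only [hw, if_pos hc] at hu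
      exact fun h0 => hu (by rw [h0, mul_zero])
    · exact absurd (by simp only [hw, if_neg hc]) hu
  have hsupp : ∀ u, w u ≠ 0 → u ∈ S.toQ.flat.box (h := h) (Lb := Lb) L Lθ J :=
    fun u hu => inv.inv.supp u (hw_pv u hu).1
  have hbound : ∀ u, |w u| ≤ P := by
    intro u
    have hP0 : (0 : ℤ) ≤ P := le_trans (abs_nonneg _) (inv.inv.bound u₀)
    by_cases hc : S.cls u = ρs
    · simp only [hw, if_pos hc, abs_mul]
      rcases hχ u with h1 | h1 <;> rw [h1] <;> simpa using inv.inv.bound u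
    · simp only [hw, if_neg hc, abs_zero]; exact hP0
  have key := SetupQPM.inv_succ_of_parts S.toQ u₀ hwu₀ hsupp hbound half
  set ε : Fin S.d → ℕ := fun j => u₀.2.1 j % 2 with hεdef
  set εθ : ℕ := u₀.2.2 % 2 with hεθdef
  set pv' : Idx S.d h Lb → ℤ := fun v => w (S.toQ.flat.reidx ε εθ v) with hpv'
  refine ⟨pv', key, ?_⟩
  obtain ⟨v₀, hv₀⟩ := key.nonzero
  set σ₁ : ℚ_[p] := S.cls v₀ with hσ₁
  have hsq : ∀ v, pv' v ≠ 0 → S.cls v ^ 2 = σ₁ ^ 2 := by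
    intro v hv
    have h1 := (hw_pv _ hv).2
    have h0 := (hw_pv _ hv₀).2
    rw [S.cls_reidx] at h1 h0
    have hprod : (∏ i, S.η i ^ S.frame.resVec ε εθ i) ≠ 0 :=
      prod_ne_zero_iff.mpr fun i _ => pow_ne_zero _ (S.η_ne i)
    have := h1.trans h0.symm
    rw [hσ₁]
    exact mul_left_cancel₀ hprod this
  refine ⟨σ₁, fun v => if S.cls v = σ₁ then 1 else -1, S.cls_pow_G v₀, ?_, ?_⟩
  · intro v _
    by_cases hc : S.cls v = σ₁
    · left; simp [hc]
    · right; simp [hc]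
  · intro v hv
    show S.cls v = ((if S.cls v = σ₁ then (1 : ℤ) else -1 : ℤ) : ℚ_[p]) * σ₁
    rcases eq_or_eq_neg_of_sq_eq' (hsq v hv) with hc | hc
    · rw [if_pos hc, hc]; push_cast; ring
    · have hne : S.cls v ≠ σ₁ := by
        intro heq
        have h2 : σ₁ = -σ₁ := heq.symm.trans hc
        have : σ₁ = 0 := by linear_combination h2 / 2
        exact S.cls_ne v₀ (hσ₁ ▸ this)
      rw [if_neg hne, hc]; push_cast; ring

end TwistSetup



end Summit.ABC.StewartYu

end
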